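import Literature.NumberTheory.LFunctions.Zhang2022.RepairSection9Theta
import Literature.NumberTheory.LFunctions.Zhang2022.RepairBoxPrimitives

/-!
# Zhang (2022) §18-margin repair rung: boxes of the mollifier-pair block at interval lengths

Trunk T-ANT (NumberTheory/LFunctions). Companion of `RepairSection9Theta.lean` (the §8/§9 constants
`b_μμ, b_LS, c_μμ, c_LS` of Y. Zhang, arXiv:2211.02515v1 [Zhang2022LandauSiegel], (8.19)–(8.23),
(9.3)–(9.7), as functionals `bDiag k ν`, `bCrossY/bCrossX k_L k_S ν_L ν_S` of the logarithmic lengths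
`ν` and the rational shift multipliers `k`) and of `RepairBoxPrimitives.lean` (box primitives with
interval lengths). It provides what the REPAIR-or-BARRIER rung (D-0077) needs to evaluate these
functionals on a whole box of lengths in the kernel:

* closed forms at a GENERAL real length: `bDiag_eq_val` (`bDiag k ν = bDiagVal k ν`, through
  `FGint … ν`), `bCrossY_eq_val` (through `FGYint … ν_S (ν_L − ν_S)`), `bCrossX_eq_val` (through
  `FGXint`); these are the `ν`-generic forms of `Section8ClosedForm.b11_eq … b12_eq`;
* box mirrors with interval lengths and validity flags: `bDiagBL k V`, `bCrossYBL/bCrossXBL k_L k_S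
  V_L V_S`, `cDiagBL`, `cCrossBL`, and their `mem` lemmas (Moore inclusion); at a degenerate interval
  `V = FI.ofRat q` they are point certificates, at `V = boxFI B i` they are cover leaves;
* regression at the printed design: `c11_mem_cDiagBL`, `c12_mem_cCrossBL`, `c33_mem_cDiagBL`,
  `c34c_mem_cCrossBL` (the printed constants lie in the boxes at the printed point), and one genuine
  interval statement `cDiag_re_bounds_near_nu1` (`∀ ν ∈ [0.5039, 0.5041]`, `3.6 < Re c(3/2, ν) < 3.625`),
  certified by a single box evaluation (`decide +kernel`; enclosure width ≈ `100 ×` box width).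

No statement about the manuscript's Theorems 1–2; no facts, no axioms beyond the standard three.
-/

noncomputable section

open Complex Real ComplexConjugate
open Literature.Analysis.ValidatedNumerics.Numerics
open Literature.Analysis.ValidatedNumerics (Box)

namespace Literature.NumberTheory.LFunctions.Zhang2022

/-! ### Closed forms at a general length -/

/-- Engine-shape closed form of `bDiag k ν`:
`(½F₁ + 2F₂ + 3/2F₃)·(1/(ν²π))`, `F_j = FGint (k−j) k r₀ (1−r₀) b ν` with the `ghMain` data of
`(j′, j″) = (2,3), (3,1), (1,2)`. [cite: Zhang2022LandauSiegel, (8.19), (8.20), (9.3)] -/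
def bDiagVal (k : ℚ) (ν : ℝ) : ℂ :=
  ((((1/2 : ℚ) : ℂ) * FGint (k - 1) k (r0Main k 2 3) (1 - r0Main k 2 3) (bMain k 2 3) ν
    + ((2 : ℚ) : ℂ) * FGint (k - 2) k (r0Main k 3 1) (1 - r0Main k 3 1) (bMain k 3 1) ν)
    + ((3/2 : ℚ) : ℂ) * FGint (k - 3) k (r0Main k 1 2) (1 - r0Main k 1 2) (bMain k 1 2) ν)
  * ((invMulPi (ν * ν) : ℝ) : ℂ)

/-- **`bDiag k ν = bDiagVal k ν`** for `k ≠ 0` and every real `ν` (fundamental theorem of calculus,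
`Section8ClosedForm.integral_ffF_mul_ghF`). [cite: Zhang2022LandauSiegel, (8.19), (8.20), (9.3)] -/
theorem bDiag_eq_val (k : ℚ) (hk : k ≠ 0) (ν : ℝ) : bDiag k ν = bDiagVal k ν := by
  have e1 := integral_ffF_mul_ghF (k - 1) k (r0Main k 2 3) (1 - r0Main k 2 3) (bMain k 2 3) hk ν
  have e2 := integral_ffF_mul_ghF (k - 2) k (r0Main k 3 1) (1 - r0Main k 3 1) (bMain k 3 1) hk ν
  have e3 := integral_ffF_mul_ghF (k - 3) k (r0Main k 1 2) (1 - r0Main k 1 2) (bMain k 1 2) hk ν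
  have hp : (1 / (ν ^ 2 * π) : ℝ) = invMulPi (ν * ν) := by unfold invMulPi; ring
  unfold bDiag diagIntegrand ffMain ghMain
  rw [integral_wsum3, e1, e2, e3, hp]
  · unfold bDiagVal; push_cast; ring
  all_goals fun_prop

/-- Engine-shape closed form of `bCrossY k_L k_S ν_L ν_S` (longer `𝔣𝔣` shifted by `s = ν_L − ν_S`):
`(½Y₁ + 2Y₂ + 3/2Y₃)·(1/(ν_Lν_Sπ))`, `Y_j = FGYint (k_L−j) k_L r₀ (1−r₀) b k_S ν_S s` with the
`ghMain k_S` data. [cite: Zhang2022LandauSiegel, (8.22), (9.5)] -/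
def bCrossYVal (kL kS : ℚ) (νL νS : ℝ) : ℂ :=
  ((((1/2 : ℚ) : ℂ) * FGYint (kL - 1) kL (r0Main kS 2 3) (1 - r0Main kS 2 3) (bMain kS 2 3) kS
      νS (νL - νS)
    + ((2 : ℚ) : ℂ) * FGYint (kL - 2) kL (r0Main kS 3 1) (1 - r0Main kS 3 1) (bMain kS 3 1) kS
      νS (νL - νS))
    + ((3/2 : ℚ) : ℂ) * FGYint (kL - 3) kL (r0Main kS 1 2) (1 - r0Main kS 1 2) (bMain kS 1 2) kS
      νS (νL - νS))
  * ((invMulPi (νL * νS) : ℝ) : ℂ)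

/-- **`bCrossY = bCrossYVal`** for `k_L ≠ 0`, `k_L ≠ k_S`
(`Section8ClosedForm.integral_ffF_shift_mul_ghF`). [cite: Zhang2022LandauSiegel, (8.22), (9.5)] -/
theorem bCrossY_eq_val (kL kS : ℚ) (hL : kL ≠ 0) (hLS : kL - kS ≠ 0) (νL νS : ℝ) :
    bCrossY kL kS νL νS = bCrossYVal kL kS νL νS := by
  have e1 := integral_ffF_shift_mul_ghF (kL - 1) kL (r0Main kS 2 3) (1 - r0Main kS 2 3)
    (bMain kS 2 3) kS hL hLS νS (νL - νS)
  have e2 := integral_ffF_shift_mul_ghF (kL - 2) kL (r0Main kS 3 1) (1 - r0Main kS 3 1)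
    (bMain kS 3 1) kS hL hLS νS (νL - νS)
  have e3 := integral_ffF_shift_mul_ghF (kL - 3) kL (r0Main kS 1 2) (1 - r0Main kS 1 2)
    (bMain kS 1 2) kS hL hLS νS (νL - νS)
  have hp : (1 / (νL * νS * π) : ℝ) = invMulPi (νL * νS) := by unfold invMulPi; ring
  unfold bCrossY crossYIntegrand ffMain ghMain
  rw [integral_wsum3, e1, e2, e3, hp]
  · unfold bCrossYVal; push_cast; ring
  all_goals fun_prop

/-- Engine-shape closed form of `bCrossX k_L k_S ν_L ν_S` (longer `𝔤𝔥` shifted by `s = ν_L − ν_S`):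
`(½X₁ + 2X₂ + 3/2X₃)·(1/(ν_Lν_Sπ))`, `X_j = FGXint (k_S−j) k_S r₀ (1−r₀) b k_L ν_S s` with the
`ghMain k_L` data. [cite: Zhang2022LandauSiegel, (8.21), (9.6)] -/
def bCrossXVal (kL kS : ℚ) (νL νS : ℝ) : ℂ :=
  ((((1/2 : ℚ) : ℂ) * FGXint (kS - 1) kS (r0Main kL 2 3) (1 - r0Main kL 2 3) (bMain kL 2 3) kL
      νS (νL - νS)
    + ((2 : ℚ) : ℂ) * FGXint (kS - 2) kS (r0Main kL 3 1) (1 - r0Main kL 3 1) (bMain kL 3 1) kL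
      νS (νL - νS))
    + ((3/2 : ℚ) : ℂ) * FGXint (kS - 3) kS (r0Main kL 1 2) (1 - r0Main kL 1 2) (bMain kL 1 2) kL
      νS (νL - νS))
  * ((invMulPi (νL * νS) : ℝ) : ℂ)

/-- **`bCrossX = bCrossXVal`** for `k_S ≠ 0`, `k_S ≠ k_L`
(`Section8ClosedForm.integral_ffF_mul_ghF_shiftR`). [cite: Zhang2022LandauSiegel, (8.21), (9.6)] -/
theorem bCrossX_eq_val (kL kS : ℚ) (hS : kS ≠ 0) (hSL : kS - kL ≠ 0) (νL νS : ℝ) :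
    bCrossX kL kS νL νS = bCrossXVal kL kS νL νS := by
  have e1 := integral_ffF_mul_ghF_shiftR (kS - 1) kS (r0Main kL 2 3) (1 - r0Main kL 2 3)
    (bMain kL 2 3) kL hS hSL νS (νL - νS)
  have e2 := integral_ffF_mul_ghF_shiftR (kS - 2) kS (r0Main kL 3 1) (1 - r0Main kL 3 1)
    (bMain kL 3 1) kL hS hSL νS (νL - νS)
  have e3 := integral_ffF_mul_ghF_shiftR (kS - 3) kS (r0Main kL 1 2) (1 - r0Main kL 1 2)
    (bMain kL 1 2) kL hS hSL νS (νL - νS)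
  have hp : (1 / (νL * νS * π) : ℝ) = invMulPi (νL * νS) := by unfold invMulPi; ring
  unfold bCrossX crossXIntegrand ffMain ghMain
  rw [integral_wsum3, e1, e2, e3, hp]
  · unfold bCrossXVal; push_cast; ring
  all_goals fun_prop

/- Keep the interval primitives opaque to the elaborator's unifier (cf. `Section8Certificate`). -/
attribute [local irreducible] CB.add CB.sub CB.mul CB.neg CB.conj CB.mulFI CB.mulI CB.mulInt
  CB.ofFI CB.ofInt CB.normSqFI CB.expI FI.add FI.sub FI.mul FI.neg FI.mulInt FI.divNat FI.divPos
  FI.ofRat FI.ofInt FI.pi qCB piMul expIpi overPiFI piISq mulPiFI scaleRatFI recipFI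
  recipMulPiFI expIpiFI

/-! ### Box mirrors at interval lengths -/

/-- Box of `bDiag k ν` for `ν` in the interval `V` (junk unless `bDiagOK k V`).
[cite: Zhang2022LandauSiegel, (8.19), (8.20), (9.3)] -/
@[irreducible] def bDiagBL (k : ℚ) (V : FI) : CB :=
  ((((qCB (1/2)).mul (FGintBL (k - 1) k (r0Main k 2 3) (1 - r0Main k 2 3) (bMain k 2 3) V)).add
    ((qCB 2).mul (FGintBL (k - 2) k (r0Main k 3 1) (1 - r0Main k 3 1) (bMain k 3 1) V))).add
    ((qCB (3/2)).mul (FGintBL (k - 3) k (r0Main k 1 2) (1 - r0Main k 1 2) (bMain k 1 2) V))).mulFI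
  (recipMulPiFI (V.mul V))

/-- validity flags of `bDiagBL` [folklore] -/
def bDiagOK (k : ℚ) (V : FI) : Bool :=
  overPiOK k⁻¹ && expIpiFIOK (scaleRatFI V k) && recipMulPiOK (V.mul V)

/-- **`bDiag k ν ∈ bDiagBL k V`** for `ν ∈ V`, `k ≠ 0`, flags set. [cite: Moore1966, Theorem 3.1] -/
theorem mem_bDiagBL {k : ℚ} (hk : k ≠ 0) {ν : ℝ} {V : FI} (hν : FI.mem ν V)
    (h : bDiagOK k V = true) : CB.mem (bDiag k ν) (bDiagBL k V) := by
  simp only [bDiagOK, Bool.and_eq_true] at h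
  obtain ⟨⟨hU, hE⟩, hR⟩ := h
  have hp := mem_recipMulPiFI hR (FI.mem_mul hν hν)
  rw [bDiag_eq_val k hk]
  unfold bDiagVal bDiagBL
  apply_rules [mem_FGintBL, CB.mem_add, CB.mem_mul, CB.mem_mulFI, mem_qCB]

/-- Box of `bCrossY k_L k_S ν_L ν_S` for `ν_L ∈ V_L`, `ν_S ∈ V_S` (junk unless `bCrossYOK`).
[cite: Zhang2022LandauSiegel, (8.22), (9.5)] -/
@[irreducible] def bCrossYBL (kL kS : ℚ) (VL VS : FI) : CB :=
  ((((qCB (1/2)).mul (FGYintBL (kL - 1) kL (r0Main kS 2 3) (1 - r0Main kS 2 3) (bMain kS 2 3) kS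
      VS (VL.sub VS))).add
    ((qCB 2).mul (FGYintBL (kL - 2) kL (r0Main kS 3 1) (1 - r0Main kS 3 1) (bMain kS 3 1) kS
      VS (VL.sub VS)))).add
    ((qCB (3/2)).mul (FGYintBL (kL - 3) kL (r0Main kS 1 2) (1 - r0Main kS 1 2) (bMain kS 1 2) kS
      VS (VL.sub VS)))).mulFI
  (recipMulPiFI (VL.mul VS))

/-- validity flags of `bCrossYBL` [folklore] -/
def bCrossYOK (kL kS : ℚ) (VL VS : FI) : Bool :=
  overPiOK kL⁻¹ && expIpiFIOK (scaleRatFI VS kL) && overPiOK (kL - kS)⁻¹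
    && expIpiFIOK (scaleRatFI VS (kL - kS)) && expIpiFIOK (scaleRatFI (VL.sub VS) kL)
    && recipMulPiOK (VL.mul VS)

/-- **`bCrossY … ∈ bCrossYBL …`** for `ν_L ∈ V_L`, `ν_S ∈ V_S`, `k_L ≠ 0`, `k_L ≠ k_S`, flags set.
[cite: Moore1966, Theorem 3.1] -/
theorem mem_bCrossYBL {kL kS : ℚ} (hL : kL ≠ 0) (hLS : kL - kS ≠ 0) {νL νS : ℝ} {VL VS : FI}
    (hνL : FI.mem νL VL) (hνS : FI.mem νS VS) (h : bCrossYOK kL kS VL VS = true) :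
    CB.mem (bCrossY kL kS νL νS) (bCrossYBL kL kS VL VS) := by
  simp only [bCrossYOK, Bool.and_eq_true] at h
  obtain ⟨⟨⟨⟨⟨hU, hE⟩, hU'⟩, hE'⟩, hS⟩, hR⟩ := h
  have hp := mem_recipMulPiFI hR (FI.mem_mul hνL hνS)
  have hs := FI.mem_sub hνL hνS
  rw [bCrossY_eq_val kL kS hL hLS]
  unfold bCrossYVal bCrossYBL
  apply_rules [mem_FGYintBL, CB.mem_add, CB.mem_mul, CB.mem_mulFI, mem_qCB]

/-- Box of `bCrossX k_L k_S ν_L ν_S` for `ν_L ∈ V_L`, `ν_S ∈ V_S` (junk unless `bCrossXOK`).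
[cite: Zhang2022LandauSiegel, (8.21), (9.6)] -/
@[irreducible] def bCrossXBL (kL kS : ℚ) (VL VS : FI) : CB :=
  ((((qCB (1/2)).mul (FGXintBL (kS - 1) kS (r0Main kL 2 3) (1 - r0Main kL 2 3) (bMain kL 2 3) kL
      VS (VL.sub VS))).add
    ((qCB 2).mul (FGXintBL (kS - 2) kS (r0Main kL 3 1) (1 - r0Main kL 3 1) (bMain kL 3 1) kL
      VS (VL.sub VS)))).add
    ((qCB (3/2)).mul (FGXintBL (kS - 3) kS (r0Main kL 1 2) (1 - r0Main kL 1 2) (bMain kL 1 2) kL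
      VS (VL.sub VS)))).mulFI
  (recipMulPiFI (VL.mul VS))

/-- validity flags of `bCrossXBL` [folklore] -/
def bCrossXOK (kL kS : ℚ) (VL VS : FI) : Bool :=
  overPiOK kS⁻¹ && expIpiFIOK (scaleRatFI VS kS) && overPiOK (kS - kL)⁻¹
    && expIpiFIOK (scaleRatFI VS (kS - kL)) && expIpiFIOK (scaleRatFI (VL.sub VS) (-kL))
    && recipMulPiOK (VL.mul VS)

/-- **`bCrossX … ∈ bCrossXBL …`** for `ν_L ∈ V_L`, `ν_S ∈ V_S`, `k_S ≠ 0`, `k_S ≠ k_L`, flags set.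
[cite: Moore1966, Theorem 3.1] -/
theorem mem_bCrossXBL {kL kS : ℚ} (hS : kS ≠ 0) (hSL : kS - kL ≠ 0) {νL νS : ℝ} {VL VS : FI}
    (hνL : FI.mem νL VL) (hνS : FI.mem νS VS) (h : bCrossXOK kL kS VL VS = true) :
    CB.mem (bCrossX kL kS νL νS) (bCrossXBL kL kS VL VS) := by
  simp only [bCrossXOK, Bool.and_eq_true] at h
  obtain ⟨⟨⟨⟨⟨hU, hE⟩, hU'⟩, hE'⟩, hS'⟩, hR⟩ := h
  have hp := mem_recipMulPiFI hR (FI.mem_mul hνL hνS)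
  have hs := FI.mem_sub hνL hνS
  rw [bCrossX_eq_val kL kS hS hSL]
  unfold bCrossXVal bCrossXBL
  apply_rules [mem_FGXintBL, CB.mem_add, CB.mem_mul, CB.mem_mulFI, mem_qCB]

/-- Box of `c_μμ = b_μμ + b̄_μμ` at interval length. [cite: Zhang2022LandauSiegel, §8 after (8.23), §9 after (9.7)] -/
@[irreducible] def cDiagBL (k : ℚ) (V : FI) : CB := (bDiagBL k V).add (bDiagBL k V).conj

/-- **`cDiag k ν ∈ cDiagBL k V`**. [cite: Moore1966, Theorem 3.1] -/
theorem mem_cDiagBL {k : ℚ} (hk : k ≠ 0) {ν : ℝ} {V : FI} (hν : FI.mem ν V)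
    (h : bDiagOK k V = true) : CB.mem (cDiag k ν) (cDiagBL k V) := by
  have hb := mem_bDiagBL hk hν h
  unfold cDiag cDiagBL
  exact CB.mem_add hb (CB.mem_conj hb)

/-- Box of `c_LS = b_Y + b̄_X` at interval lengths. [cite: Zhang2022LandauSiegel, §8 after (8.23), §9 after (9.7)] -/
@[irreducible] def cCrossBL (kL kS : ℚ) (VL VS : FI) : CB :=
  (bCrossYBL kL kS VL VS).add (bCrossXBL kL kS VL VS).conj

/-- validity flags of `cCrossBL` [folklore] -/
def cCrossOK (kL kS : ℚ) (VL VS : FI) : Bool := bCrossYOK kL kS VL VS && bCrossXOK kL kS VL VS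

/-- **`cCross … ∈ cCrossBL …`** (`k_L, k_S ≠ 0`, `k_L ≠ k_S`). [cite: Moore1966, Theorem 3.1] -/
theorem mem_cCrossBL {kL kS : ℚ} (hL : kL ≠ 0) (hS : kS ≠ 0) (hLS : kL ≠ kS) {νL νS : ℝ}
    {VL VS : FI} (hνL : FI.mem νL VL) (hνS : FI.mem νS VS) (h : cCrossOK kL kS VL VS = true) :
    CB.mem (cCross kL kS νL νS) (cCrossBL kL kS VL VS) := by
  simp only [cCrossOK, Bool.and_eq_true] at h
  have hY := mem_bCrossYBL hL (sub_ne_zero.2 hLS) hνL hνS h.1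
  have hX := mem_bCrossXBL hS (sub_ne_zero.2 (Ne.symm hLS)) hνL hνS h.2
  unfold cCross cCrossBL
  exact CB.mem_add hY (CB.mem_conj hX)

/-! ### Regression at the printed design, and one genuine interval statement -/

/-- `0.504 = 63/125`, `0.5 = 1/2`, `0.498 = 249/500` as casts of rationals. [folklore] -/
private theorem printed_lengths :
    (0.504 : ℝ) = ((63/125 : ℚ) : ℝ) ∧ (0.5 : ℝ) = ((1/2 : ℚ) : ℝ) ∧ (0.498 : ℝ) = ((249/500 : ℚ) : ℝ) := by
  refine ⟨?_, ?_, ?_⟩ <;> norm_num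

/-- `c₁₁ ∈ cDiagBL (3/2) [0.504]` (the printed constant in the point box at the printed length).
[cite: Zhang2022LandauSiegel, (8.19)] -/
theorem c11_mem_cDiagBL : CB.mem c11 (cDiagBL (3/2) (FI.ofRat (63/125))) := by
  have hok : bDiagOK (3/2) (FI.ofRat (63/125)) = true := by decide +kernel
  rw [c11_eq_cDiag, printed_lengths.1]
  exact mem_cDiagBL (by norm_num) (FI.mem_ofRat _) hok

/-- `c₃₃ ∈ cDiagBL (3/2) [0.498]`. [cite: Zhang2022LandauSiegel, (9.3)] -/
theorem c33_mem_cDiagBL : CB.mem c33 (cDiagBL (3/2) (FI.ofRat (249/500))) := by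
  have hok : bDiagOK (3/2) (FI.ofRat (249/500)) = true := by decide +kernel
  rw [c33_eq_cDiag, printed_lengths.2.2]
  exact mem_cDiagBL (by norm_num) (FI.mem_ofRat _) hok

/-- `c₂₂ ∈ cDiagBL (5/2) [0.5]`. [cite: Zhang2022LandauSiegel, (8.20)] -/
theorem c22_mem_cDiagBL : CB.mem c22 (cDiagBL (5/2) (FI.ofRat (1/2))) := by
  have hok : bDiagOK (5/2) (FI.ofRat (1/2)) = true := by decide +kernel
  rw [c22_eq_cDiag, printed_lengths.2.1]
  exact mem_cDiagBL (by norm_num) (FI.mem_ofRat _) hok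

/-- `c₁₂ ∈ cCrossBL (3/2) (5/2) [0.504] [0.5]`. [cite: Zhang2022LandauSiegel, §8 after (8.23)] -/
theorem c12_mem_cCrossBL :
    CB.mem c12 (cCrossBL (3/2) (5/2) (FI.ofRat (63/125)) (FI.ofRat (1/2))) := by
  have hok : cCrossOK (3/2) (5/2) (FI.ofRat (63/125)) (FI.ofRat (1/2)) = true := by decide +kernel
  rw [c12_eq_cCross, printed_lengths.1, printed_lengths.2.1]
  exact mem_cCrossBL (by norm_num) (by norm_num) (by norm_num) (FI.mem_ofRat _) (FI.mem_ofRat _) hok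

/-- `c34c ∈ cCrossBL (5/2) (3/2) [0.5] [0.498]` (derived-prefactor reading of (9.5)–(9.6)).
[cite: Zhang2022LandauSiegel, §9 after (9.7)] -/
theorem c34c_mem_cCrossBL :
    CB.mem c34c (cCrossBL (5/2) (3/2) (FI.ofRat (1/2)) (FI.ofRat (249/500))) := by
  have hok : cCrossOK (5/2) (3/2) (FI.ofRat (1/2)) (FI.ofRat (249/500)) = true := by decide +kernel
  rw [c34c_eq_cCross, printed_lengths.2.1, printed_lengths.2.2]
  exact mem_cCrossBL (by norm_num) (by norm_num) (by norm_num) (FI.mem_ofRat _) (FI.mem_ofRat _) hok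

/-- The box of `c(3/2, ν)` over the length interval `[0.5039, 0.5041]` and the two endpoint
comparisons of the regression statement. [cite: Zhang2022LandauSiegel, (8.19)] -/
def cDiagNearCert : Prop :=
  bDiagOK (3/2) (FI.ofRatRat (5039/10000) (5041/10000)) = true ∧
  (3.6 : ℚ) * (SC : ℚ) < ((cDiagBL (3/2) (FI.ofRatRat (5039/10000) (5041/10000))).re.lo : ℚ) ∧
  (((cDiagBL (3/2) (FI.ofRatRat (5039/10000) (5041/10000))).re.hi : ℚ) < (3.625 : ℚ) * (SC : ℚ))

/-- Decidability of the regression comparisons. [folklore] -/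
instance : Decidable cDiagNearCert := by unfold cDiagNearCert; infer_instance

/-- The kernel check of `cDiagNearCert` (one interval evaluation of a §8 diagonal constant over a
length box of width `2·10⁻⁴`; the computed enclosure is `[3.6031, 3.6226]`, i.e. the natural
interval extension over-estimates the range by ≈ `100 ×` the box width — the number that sizes
cover leaves). [cite: Moore1966, Theorem 3.1] -/
theorem cDiagNearCert_holds : cDiagNearCert := by decide +kernel

/-- **A genuine interval statement, certified by ONE box evaluation**: for every length
`ν ∈ [0.5039, 0.5041]`, `3.6 < Re c(3/2, ν) < 3.625` (at `ν = 0.504` this is `c₁₁ = 3.61226…`). The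
pattern of a cover leaf: `mem_cDiagBL` at `V = [lo, hi]` plus endpoint comparisons in the kernel.
[cite: Zhang2022LandauSiegel, (8.19)] -/
theorem cDiag_re_bounds_near_nu1 {ν : ℝ} (h1 : (0.5039 : ℝ) ≤ ν) (h2 : ν ≤ 0.5041) :
    (3.6 : ℝ) < (cDiag (3/2) ν).re ∧ (cDiag (3/2) ν).re < 3.625 := by
  obtain ⟨hok, hlo, hhi⟩ := cDiagNearCert_holds
  have hν : FI.mem ν (FI.ofRatRat (5039/10000) (5041/10000)) :=
    FI.mem_ofRatRat (by norm_num at h1 ⊢; exact h1) (by norm_num at h2 ⊢; exact h2)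
  have hm := mem_cDiagBL (k := 3/2) (by norm_num) hν hok
  exact ⟨by exact_mod_cast lo_bound hm.1 hlo, by exact_mod_cast hi_bound hm.1 hhi⟩

end Literature.NumberTheory.LFunctions.Zhang2022
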